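import Summits.QuantumFields.YangMills.Theses.BalabanUVNodes
import Summits.QuantumFields.YangMills.Theorems.BalabanUVNodesN27AtAllPinsOfRecord13CoPHVCutBFreeBareLedgerReadingN16Produced
import Summits.QuantumFields.YangMills.Theorems.BalabanUVNodesN20OffLiveOneTermReading

/-!
# ★ K3⁸ LEAF MWBNOⱽ — leaf `…SepCoPHVAllPinsOfRecordVBFreeBareLedgerReadingN16ProducedOneTerm` (dag-n27-c g16: BARE LEDGER READING, N16 rows produced; off-live at the ONE-TERM reading) — MINTED: the four v5∕v6 reading pins DISCHARGED (`rfl`), the ledger-reading face, the N16 letter rows of the reading and every keyed bundle at the SPELLED BUNDLE OF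
# SQUEEZED LEDGER READING live and off-live) WITH ITS FOUR v5∕v6 READING PINS DISCHARGED (`rfl`), both link-reading faces at the SPELLED BUNDLE OF LETTERS, no rate reading `𝔯` in the statement
# (cell `pub-ymgap`, D-0062 Track A; WIDTH SEAT `pub-ymgap-dag-n27-w1` gen 4; dag-n27-c «minted twins of the `…SepCoPHV…` leaves = YOURS» l.35881; K3⁸ = stmt-QuantumFields-27366, `--supports 27366 --as helper`;
# COUNT-NEUTRAL; ONE theorem ⊢ THE ITEM `Theses.BalabanUVNodes.SpineGivenEndpointR13SepCoPHV`, 0 `def`, 0 `sorry`; route-facing leaf, nothing may import it; imports = the parent's own, the parent NOT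
# imported; `N = 2`; siblings MWLⱽ · MWCⱽ)

WHY.  gen 3 (p608315 ∕ p609478) and gen 4 (`K3V6StubsLetterForm` p629121): the stub TEXTS ⟺ READING-FREE LETTER FORMS; the all-pins reading is MINTED for every letter choice
(`𝔯 := ⟨fun F θ hP g₀ os ↦ ⟨objectsOfRecord₁₃ F N θ (ℓ F θ), fun _ ↦ loose N16 layer (ℓ₃, B), fun _ ↦ fullGSizedObjects 3 F.hL b a_S …⟩, ne1OfRecord l₀ Λ⟩`, four `rfl`) and its bundle IS the
spelled bundle of letters, so every all-pins storey ∕ leaf has a twin with NO rate reading in its statement: the parent's binders with the four pin lines REPLACED by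
`(hl₀ : 0 < l₀) (hΛ : 0 ≤ Λ) (hb : 0 < b) (haS : 0 < aS)`, the link-reading faces' `let R := rateCarriersOfRecord₁₃CoPH 𝔯 …` and every other keyed bundle SPELLED; proofs = the parent's
bodies VERBATIM behind the minting prelude (generator `gen_minted.py`, regression-identical on g3's APK ↦ MPK ∕ AKL ↦ MKL; g3's MPW p616290 ∕ MWL p617292 are the v5 precedents of exactly this edition).
* ★★★ `spineGivenEndpointR13SepCoPHV_of_liveMintedV5PinsAtCrOfRecord₁₃VAt_cut_squeezedLedgerReadingV_offLive_mintedV5Pins_squeezedLedgerReading` — the slot's (B) ∕ END antecedents DISCARDED exactly as in the parent (DEF-1's `rfl` faces).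

HONEST FRAMING.  COMPOSITE-node bookkeeping BY NAME; NOT a discharge: a term of the item's type under displayed hypotheses (audit `proof.conditional`); `hlink`∕`hlinkSqzV`∕`hlinkCoreV` = NODE O's world at the runs of record — UNPRINTED content for d = 4, 0 instances; `hβw` =
the K1 window currency (K1⁹ OPEN); every displayed antecedent is a HYPOTHESIS inhabited for no family today (K0⁷ `Record13SepCoPHInhabited` OPEN) or a decided MODEL inside the minted reading
(n14-w1's datum-read tower, dag-n15-a's sized genuine family — MODEL LEVEL, v5∕v6's own labels); the finite-volume kernel letters are Bałaban-type SHAPES NOT PRINTED as such for d = 4, proved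
nowhere; THE END's N16 sentence a hypothesis; NE7b ∕ NE7c witnesses ∕ the N19′ edge 0∕1 today; nothing of Bałaban's asserted or instantiated; NOT `stub_rates13HV` ∕ `stub_expansion13HV`; N11 ∕
N14–N22 ∕ N27 NOT discharged; K3⁸ stmt-QuantumFields-27366 OPEN, NOT claimed; skeleton v6 and every landed decl UNTOUCHED; K3⁷ 20544 aside; counts UNMOVED (typed 28∕28 · discharged 5∕27, A 5∕28);
one finite four-torus programme at fixed `ε` — R4 closes the CONDITIONAL finite-𝕋⁴ rung `BalabanLadder.UV` only: NOT ℝ⁴, NOT infinite volume, NOT OS, NOT a mass gap, NOT Clay.  No decl below carries a cite tag.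
-/

set_option autoImplicit false

namespace Summit.QuantumFields.YangMills.Theorems.BalabanUVNodesN27SpineRecord
open scoped BigOperators Matrix Matrix.Norms.L2Operator
open Finset MeasureTheory
open Literature.MathematicalPhysics.QuantumFieldTheory.Balaban1983to89
open T4OutputRate T4RecentScale T4GoodClassBudget T4CauchySum T4TowerRateComposition T4TowerRateDischarge
open T4EtaRateMin (Readings NE3Shape)
open T4RateLiaison (GaugeDominated)
open FlowStep (RGEqH prefixOf)
open TreeLengthTorus (TFaceConnected torusTreeLen)
open B12TreeDecay (kappa₀)
open Summit.QuantumFields.BalabanUV.T4Continuum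
open AveragingDeficitDualResidual (dualC1 dualC2)
open AveragingDeficitDerivWallProof (wallConst)
open AveragingDeficitPeriodicCounting (IsPeriodicDir)
open MinimalActionSandwich (IsMinimiser minAct)
open MinimalActionRate (sfClass)
open MinimalActionRefine (RegularSup gradConst)
open NE3EnergyShapes (IsUnitarySite IsPeriodicSite)
open NE3.LeafIndexSockets (LeafH3sup)
open Summit.QuantumFields.BalabanUV.T4Continuum.Spine
open Summit.QuantumFields.BalabanUV.T4Continuum.Spine.NE4 (runFlow)
open Summit.QuantumFields.BalabanUV.T4Continuum.NE1p.DressedRoot (DressedTower DressedStabilityStrict)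
open Summit.QuantumFields.YangMills.BalabanUVNodes.N19LedgerLinkSync (LedgerDataSync LedgerAtSync)
open YMDAG.UVSplit
open Summit.QuantumFields.YangMills.BalabanUVNodes.N16HolderDefs (CovRootHolder N16HolderAt)
open Summit.QuantumFields.YangMills.BalabanUVNodes.SpineRatesHolder (RatesHolderAt)
open Literature.MathematicalPhysics.QuantumFieldTheory.Balaban1983to89.T4Continuum (T4Family ULoop)
open Node00 (Stage13HParams datumOfRecord₁₃CoPH SiteSeqKey U3Letters₁₁ NE3Letters₁₁ ne3ConstLayerOfRecord₁₁ ne3NperOfRecord₁₁ ne3DomOfRecord₁₁ ZetaMeasurable ppSelLiveOfRecord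
  EOfRecord₁₃ wOfRecord₉ localBgMeasurable)
open Literature.MathematicalPhysics.QuantumFieldTheory.Balaban1983to89.B12Sec2to5 (betaPrime510)
open Literature.MathematicalPhysics.QuantumFieldTheory.Balaban1983to89.Node00.U3OfKernels (objectsOfRecord₁₃ KernelDecayOfRecord₁₃)
open Literature.MathematicalPhysics.QuantumFieldTheory.Balaban1983to89.Node00.U3KernelLetters (GeometricIncrementsOfRecord₁₃ WindowedNE9OfRecord₁₃ WindowedDecayOfRecord₁₃
  WindowedStepRateOfRecord₁₃)
open Summit.QuantumFields.YangMills.BalabanUVNodes.N16PinnedLayer13CoPH (N16PinnedLoose N16LettersEnd rateCarriers_ne3_of_pinnedLoose)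
open Summit.QuantumFields.YangMills.BalabanUVNodes.N19TargetClassWeightsE1Keyed
open YMDAG.N14.TopBorn (ne1OfRecord Ne1PinnedOfRecord n14At_rateCarriersOfRecord₁₃CoPH_of_pinned)
open Summit.QuantumFields.YangMills.BalabanUVNodes.N15.GenuineRecord (fullGSizedObjects n15At_fullGSizedObjects_family)
open Summit.QuantumFields.YangMills.BalabanUVNodes.N15.AtKeyedHome (neZero_blockFactor)
open YMDAG.N18.PolLimitRate (u3KernelInputs_of_finiteVolumeLetters)
open T4WeightBudget T4IndicatorShell T4ContinuumYM4Torus T4ApexHybrid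
open Summit.QuantumFields.YangMills.Theses.BalabanUVNodes (SpineGivenEndpointR13SepCoPHV)
open NE7 (Target)
open Summit.QuantumFields.YangMills.BalabanUVNodes.N20OffLiveOneTermReading (crOneTerm₁₃ h20_shape_crOneTerm₁₃ h21_shape_crOneTerm₁₃ extraction_crOneTerm₁₃ core_crOneTerm₁₃_iff_target)
variable (K₀ : ℕ) (jc : (F : T4Family) → (θ : Stage13HParams F 2) → θ.Provisos₁₃CoPH F 2 → (ℕ → ℝ) → List (ULoop F) → ℕ → ℕ)
  (sh : ShellSplit₁₃CoPH 2 K₀)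
  (β : ℝ)
  -- the LETTERS of the minted reading (N14 tower `l₀ Λ`; the sized genuine N15 family `b a_S ν μ α β′ c₃₅ p`; N16's letters `ℓ₃`, radius letter `B`; U3 block `ℓ` below)
  (l₀ Λ b aS : ℝ) (ν μ α β' : Fin 4) (c35 p : ℝ)
  (ℓ : (F : T4Family) → Stage13HParams F 2 → U3Letters₁₁) (s : (F : T4Family) → Stage13HParams F 2 → ℕ) (r : (F : T4Family) → Stage13HParams F 2 → ℝ)
  (ℓ₃ : T4Family → NE3Letters₁₁) (g B c' : T4Family → ℝ)

/-- ★★★ **THE ITEM AT EVERY VERSION SLOT FROM THE MINTED ALL-PINS READING, NODE O's LINK READING LIVE AND OFF-LIVE** — the parent's theorem with the four pin lines ↦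
`(hl₀ : 0 < l₀) (hΛ : 0 ≤ Λ) (hb : 0 < b) (haS : 0 < aS)` and both link-reading faces' bundles SPELLED; body VERBATIM behind the minting prelude.  No rate reading in the statement.  NOT a discharge;
every row a HYPOTHESIS (NODE O's world UNPRINTED, 0 instances) or a decided MODEL (K0⁷ OPEN); no stub closed. [bookkeeping] -/
theorem spineGivenEndpointR13SepCoPHV_of_liveMintedV5PinsAtCrOfRecord₁₃VAt_cut_bareLedgerReadingV_n16Produced_offLiveOneTerm_mintedV5Pins_bFree
    (ksel : (F : T4Family) → (θ : Stage13HParams F 2) → θ.Provisos₁₃CoPH F 2 → (ℕ → ℝ) → List (ULoop F) → ℕ)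
    (hl₀ : 0 < l₀) (hΛ : 0 ≤ Λ) (hb : 0 < b) (haS : 0 < aS)
    (h16 : ∀ (F : T4Family), (∃ θ : Stage13HParams F 2, θ.Provisos₁₃CoPH F 2 ∧ (θ.ZhUnity F 2 ∧ θ.SlotsNondegenerate₁₃ F 2) ∧ θ.Admissible F 2) →
      N16HolderAt (ne3OfRecord₁₁ F { ne3ConstLayerOfRecord₁₁ F 2 (ℓ₃ F) with
        dom := {V | V ∈ ne3DomOfRecord₁₁ F 2 0 0 ∧ V ∈ sfClass 4 F.L (ne3NperOfRecord₁₁ F 0 0) ((ℓ₃ F).ε / B F) 0} }) β)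
    (hs : ∀ (F : T4Family) (θ : Stage13HParams F 2), θ.Provisos₁₃CoPH F 2 → (θ.ZhUnity F 2 ∧ θ.SlotsNondegenerate₁₃ F 2) → θ.Admissible F 2 → (ℓ F θ).Signs)
    (hκ : ∀ (F : T4Family) (θ : Stage13HParams F 2), θ.Provisos₁₃CoPH F 2 → (θ.ZhUnity F 2 ∧ θ.SlotsNondegenerate₁₃ F 2) → θ.Admissible F 2 → 0 < (ℓ F θ).κ)
    (hcr : ∀ (F : T4Family) (θ : Stage13HParams F 2), θ.Provisos₁₃CoPH F 2 → (θ.ZhUnity F 2 ∧ θ.SlotsNondegenerate₁₃ F 2) → θ.Admissible F 2 →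
      betaPrime510 4 1 (ℓ F θ).κ ≤ (ℓ F θ).cr)
    (hκ₀ : ∀ (F : T4Family) (θ : Stage13HParams F 2), θ.Provisos₁₃CoPH F 2 → (θ.ZhUnity F 2 ∧ θ.SlotsNondegenerate₁₃ F 2) → θ.Admissible F 2 → kappa₀ (4 * 2 ^ 4) (2 * 4) ≤ (ℓ F θ).κ)
    (hr : ∀ (F : T4Family) (θ : Stage13HParams F 2), θ.Provisos₁₃CoPH F 2 → (θ.ZhUnity F 2 ∧ θ.SlotsNondegenerate₁₃ F 2) → θ.Admissible F 2 → r F θ < 1)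
    (hinc : ∀ (F : T4Family) (θ : Stage13HParams F 2), θ.Provisos₁₃CoPH F 2 → (θ.ZhUnity F 2 ∧ θ.SlotsNondegenerate₁₃ F 2) → θ.Admissible F 2 →
      GeometricIncrementsOfRecord₁₃ F 2 θ.toStage13Params (r F θ))
    (hS : ∀ (F : T4Family) (θ : Stage13HParams F 2), θ.Provisos₁₃CoPH F 2 → (θ.ZhUnity F 2 ∧ θ.SlotsNondegenerate₁₃ F 2) → θ.Admissible F 2 →
      WindowedStepRateOfRecord₁₃ F 2 θ.toStage13Params (s F θ) (ℓ F θ).κ (ℓ F θ).θ₅ ((ℓ F θ).C₅ * (ℓ F θ).θ₅))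
    (h9 : ∀ (F : T4Family) (θ : Stage13HParams F 2), θ.Provisos₁₃CoPH F 2 → (θ.ZhUnity F 2 ∧ θ.SlotsNondegenerate₁₃ F 2) → θ.Admissible F 2 →
      WindowedNE9OfRecord₁₃ F 2 θ.toStage13Params (ℓ F θ).κ (ℓ F θ).moduli)
    (hWall : ∀ (μ ν : Fin 4) (F : T4Family) (θ : Stage13HParams F 2), θ.Provisos₁₃CoPH F 2 → (θ.ZhUnity F 2 ∧ θ.SlotsNondegenerate₁₃ F 2) → θ.Admissible F 2 →
      WindowedDecayOfRecord₁₃ F 2 θ.toStage13Params μ ν (ℓ F θ).κ)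
    (hβ23 : 2 / 3 < β) (hβ1 : β ≤ 1)
    (hmatch : ∀ F : T4Family, 0 < B F ∧ (ℓ₃ F).ε / B F ≤ (ℓ₃ F).b)
    (hend : N16LettersEnd 2 g ℓ₃)
    (hradii : ∀ F : T4Family, (ℓ₃ F).g = gradConst 4 (c' F) ∧ 0 ≤ c' F ∧ 0 < c' F ∧ (ℓ₃ F).b ≤ c' F ∧
      (2 : ℝ) ^ 91 * (F.L : ℝ) ^ 17 * c' F ≤ 1 ∧ (2 : ℝ) ^ 76 * (F.L : ℝ) ^ 12 * c' F ≤ (ℓ₃ F).ε ∧ (ℓ₃ F).ε / B F ≤ 1 / 4 ∧ 4 * ((ℓ₃ F).ε / B F) ≤ c' F)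
    (hclass : ∀ F : T4Family, 16 * B7Prop2Explicit.C0 4 * (ℓ₃ F).ε ≤ 3 ∧ 1024 * (4 + 1) * (4 + 4) * (F.L : ℝ) ^ 2 * (ℓ₃ F).ε ≤ 1)
    (ρ c εTop : T4Family → ℝ)
    (hloose : ∀ F : T4Family, LeafH3sup 4 F.L (ne3NperOfRecord₁₁ F 0 0) (ρ F) (ρ F) (c F)
      ({V | V ∈ ne3DomOfRecord₁₁ F 2 0 0 ∧ V ∈ sfClass 4 F.L (ne3NperOfRecord₁₁ F 0 0) ((ℓ₃ F).ε / B F) 0} : Set (B7Prop1Explicit.Site 4 → Fin 4 → (Node00.MatA 2)ˣ)))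
    (hρε : ∀ F : T4Family, ρ F ≤ (ℓ₃ F).ε)
    (hεT : ∀ F : T4Family, (ℓ₃ F).ε ≤ εTop F)
    (h8P : ∀ (F : T4Family), ∀ V ∈ ({V | V ∈ ne3DomOfRecord₁₁ F 2 0 0 ∧ V ∈ sfClass 4 F.L (ne3NperOfRecord₁₁ F 0 0) ((ℓ₃ F).ε / B F) 0} :
        Set (B7Prop1Explicit.Site 4 → Fin 4 → (Node00.MatA 2)ˣ)), ∀ k : ℕ, ∃ U₀ : B7Prop1Explicit.Site 4 → Fin 4 → (Node00.MatA 2)ˣ,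
      U₀ ∈ sfClass 4 F.L (ne3NperOfRecord₁₁ F 0 0) (ρ F) (k + 1) ∧
        IsMinimiser 4 (sfClass 4 F.L (ne3NperOfRecord₁₁ F 0 0) (εTop F)) F.L (ne3NperOfRecord₁₁ F 0 0) (k + 1) V U₀)
    (hU6loc : ∀ (F : T4Family) (k : ℕ), ∀ V ∈ ({V | V ∈ ne3DomOfRecord₁₁ F 2 0 0 ∧ V ∈ sfClass 4 F.L (ne3NperOfRecord₁₁ F 0 0) ((ℓ₃ F).ε / B F) 0} :
        Set (B7Prop1Explicit.Site 4 → Fin 4 → (Node00.MatA 2)ˣ)),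
      ∀ U₀ : B7Prop1Explicit.Site 4 → Fin 4 → (Node00.MatA 2)ˣ, IsMinimiser 4 (sfClass 4 F.L (ne3NperOfRecord₁₁ F 0 0) (ρ F)) F.L (ne3NperOfRecord₁₁ F 0 0) (k + 1) V U₀ →
      ∀ U : B7Prop1Explicit.Site 4 → Fin 4 → (Node00.MatA 2)ˣ, U ∈ sfClass 4 F.L (ne3NperOfRecord₁₁ F 0 0) (εTop F) (k + 1) → B7Prop2Explicit.avgIter F.L U (k + 1) = V →
        U ∈ sfClass 4 F.L (ne3NperOfRecord₁₁ F 0 0) (ℓ₃ F).ε (k + 1) →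
        IsLocalMinOn (fun W : B7Prop1Explicit.Site 4 → Fin 4 → (Node00.MatA 2)ˣ => MinimalActionLevels.levelAction 4 F.L (ne3NperOfRecord₁₁ F 0 0) (k + 1) W)
          (MinimalActionSandwich.admissible (sfClass 4 F.L (ne3NperOfRecord₁₁ F 0 0) (εTop F)) F.L (k + 1) V) U →
        ∃ u : B7Prop1Explicit.Site 4 → (Node00.MatA 2)ˣ, IsUnitarySite u ∧ IsPeriodicSite u ((ne3NperOfRecord₁₁ F 0 0 * F.L ^ (k + 1) : ℕ) : ℤ) ∧ B7Prop1Explicit.gaugeAct u U₀ = U)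
    (hρb : ∀ F : T4Family, ρ F ≤ (ℓ₃ F).b)
    (hc : ∀ F : T4Family, c F ≤ c' F)
    (hβw : ∀ (F : T4Family) (θ : Stage13HParams F 2) (hP : θ.Provisos₁₃CoPH F 2), (θ.ZhUnity F 2 ∧ θ.SlotsNondegenerate₁₃ F 2) → θ.Admissible F 2 →
      ∃ γ₀ b b' : ℝ, 0 < γ₀ ∧ 0 < b ∧ DagBinding.BetaBoundsInInterval (datumOfRecord₁₃CoPH F 2 θ hP).C.toB12 γ₀ b b')
    (hζm : ∀ (F : T4Family) (θ : Stage13HParams F 2), θ.Provisos₁₃CoPH F 2 → ((θ.ZhUnity F 2 ∧ θ.SlotsNondegenerate₁₃ F 2) ∧ θ.ppSel = ppSelLiveOfRecord F 2 θ.ν θ.τ9 (EOfRecord₁₃ F 2 θ.toStage13Params) (wOfRecord₉ F 2 θ.toStage9Params)) → θ.Admissible F 2 →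
      ZetaMeasurable F 2 θ.ζ)
    (h20 : ∀ (F : T4Family) (θ : Stage13HParams F 2) (hP : θ.Provisos₁₃CoPH F 2), ((θ.ZhUnity F 2 ∧ θ.SlotsNondegenerate₁₃ F 2) ∧ θ.ppSel = ppSelLiveOfRecord F 2 θ.ν θ.τ9 (EOfRecord₁₃ F 2 θ.toStage13Params) (wOfRecord₉ F 2 θ.toStage9Params)) → θ.Admissible F 2 →
      ∀ (g₀ : ℕ → ℝ) (os : List (ULoop F)),
        ∃ W : ℕ → ℝ, RelWeightBound 1 (classSet₁₃ θ K₀ g₀) (weightA₁₃ θ hP K₀ g₀ os) (weightB₁₃ θ hP K₀ g₀ os) (badClass₁₃ θ K₀ g₀ (jc F θ hP g₀ os)) W)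
    (h21 : ∀ (F : T4Family) (θ : Stage13HParams F 2) (hP : θ.Provisos₁₃CoPH F 2), ((θ.ZhUnity F 2 ∧ θ.SlotsNondegenerate₁₃ F 2) ∧ θ.ppSel = ppSelLiveOfRecord F 2 θ.ν θ.τ9 (EOfRecord₁₃ F 2 θ.toStage13Params) (wOfRecord₉ F 2 θ.toStage9Params)) → θ.Admissible F 2 →
      ∀ (g₀ : ℕ → ℝ) (os : List (ULoop F)),
        ∃ Wsh : ℕ → ℝ, ShellWeightBound 1 (classSet₁₃ θ K₀ g₀) (weightA₁₃ θ hP K₀ g₀ os) (weightB₁₃ θ hP K₀ g₀ os) (sh F θ hP g₀ os).1 (sh F θ hP g₀ os).2 Wsh)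
    (hlinkBareV : ∀ (F : T4Family) (θ : Stage13HParams F 2) (hP : θ.Provisos₁₃CoPH F 2), ((θ.ZhUnity F 2 ∧ θ.SlotsNondegenerate₁₃ F 2) ∧ θ.ppSel = ppSelLiveOfRecord F 2 θ.ν θ.τ9 (EOfRecord₁₃ F 2 θ.toStage13Params) (wOfRecord₉ F 2 θ.toStage9Params)) → θ.Admissible F 2 →
      ∀ (γ gIR b : ℝ) (g₀ : ℕ → ℝ), (datumOfRecord₁₃CoPH F 2 θ hP).Tuned γ gIR g₀ → γ ≤ θ.γ → γ ^ 2 ≤ Real.exp (-1) → 0 < b →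
      (∀ K m, 0 ≤ m → m < K → b ≤ (datumOfRecord₁₃CoPH F 2 θ hP).βfun m (prefixOf (runFlow (datumOfRecord₁₃CoPH F 2 θ hP) g₀ K) m)) →
      ∀ (os : List (ULoop F)) (k : ℕ),
      let S : SpineCarriers := crOfRecord₁₃VAt K₀ (jc F θ hP g₀ os) sh F θ hP g₀ os
      let R : RateCarriers 2 :=
        ⟨ne1OfRecord l₀ Λ F θ hP g₀ os, ne2OfRecord₁₁ (haveI := neZero_blockFactor F; fullGSizedObjects 3 F.hL b aS ν μ α β' c35 p),
          ne3OfRecord₁₁ F { ne3ConstLayerOfRecord₁₁ F 2 (ℓ₃ F) with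
            dom := {V | V ∈ ne3DomOfRecord₁₁ F 2 0 0 ∧ V ∈ sfClass 4 F.L (ne3NperOfRecord₁₁ F 0 0) ((ℓ₃ F).ε / B F) 0} },
          u3OfRecord₁₃ θ.toStage13Params (objectsOfRecord₁₃ F 2 θ.toStage13Params (ℓ F θ)) k⟩
      let D : Datum F 2 := datumOfRecord₁₃CoPH F 2 θ hP
      letI := S.dec
      ∃ (_ : DecidableEq R.u3.C.Dom) (F' : Type) (ι' X' : Type) (_ : MeasurableSpace ι')
        (L : LedgerDataSync R.u3.C F' ι' S.ι) (Rd : Readings ι' X') (bsel : (ℕ → ℝ) → ℝ) (EB : Functional R.u3.C R.u3.C.BgB)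
        (g : ℕ → ℕ → ℝ)
        (uA : ℕ → ι' → R.u3.C.BgA) (uB : ℕ → ι' → R.u3.C.BgB)
        (Koff : ℕ) (cells : (K j : ℕ) → R.u3.C.Dom → Finset (Site (F.P (Koff + K)) j))
        (θ : ℝ)
        (rd : ι' → (B7Prop1Explicit.Site 4 → Fin 4 → (Matrix (Fin 2) (Fin 2) ℂ)ˣ)),
        (∀ K i, i ≤ K → g K i = runFlow D g₀ K i) ∧ (∀ K i, K < i → g K i = gIR) ∧
        EB = (fun s => R.u3.EB (bsel s) s) ∧
        (∀ (Sz : ℕ → ℝ → S.ι → ℕ → ℝ) (E₀ : ℝ) (m : ℕ) (a : ℝ) (Cw Λg : ℝ),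
          (∀ K t, |t| ≤ S.l₀ → ∀ τ ∈ S.T K \ S.Bad K t, ∀ v ∈ Rd.dom, ∀ j ≤ K,
            |∑ X ∈ L.fac K t τ with R.u3.C.scale X = j,
                (Real.log (Real.exp (EB (fun i => g (K + 1) (i + 1)) (uB K v) X
                    - EB (fun i => g (K + 1) (i + 1)) L.oneB X))
                  - Real.log (Real.exp (R.u3.EA (g K) (uA K v) X - R.u3.EA (g K) L.oneA X)))| ≤ Sz K t τ j) →
          0 ≤ E₀ → 0 < a → a < 1 →
          (∀ K t, |t| ≤ S.l₀ → ∀ τ ∈ S.T K \ S.Bad K t, ∀ j ≤ K,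
            Sz K t τ j ≤ S.vol * (E₀ * ((K : ℝ) + 1) ^ m * a ^ (K - j))) →
          (∀ K, Multiplicity (L.All K) R.u3.C.scale (fun X => Real.exp (-(R.u3.κ * R.u3.C.d X))) Cw S.vol Λg K) →
          (∀ K t, |t| ≤ S.l₀ → ∀ τ ∈ S.T K \ S.Bad K t,
            WindowMultiplicity (L.facO K t τ) L.scO L.wO Cw S.vol Λg (jlogOf L.Cl K) K) →
          1 ≤ Λg → L.θ' ≤ Λg →
          LedgerAtSync { L with S := Sz, E₀ := E₀, m := m, a := a, Cw := Cw, Λg := Λg } S.l₀ S.vol S.T S.Bad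
            (fun K t τ => S.A K t τ - S.shA K t τ) (fun K t τ => S.B K t τ - S.shB K t τ) Rd R.u3.EA EB R.u3.κ g uA uB
            R.u3.ω R.u3.ρ R.u3.θ (θ ^ ((3 : ℝ) * β - 2))) ∧
        (∀ K t, |t| ≤ S.l₀ → ∀ τ ∈ S.T K \ S.Bad K t,
          WindowMultiplicity (L.facO K t τ) L.scO L.wO L.Cw S.vol L.Λg (jlogOf L.Cl K) K) ∧
        0 ≤ L.Cw ∧ 1 ≤ L.Λg ∧ L.θ' ≤ L.Λg ∧
        (∀ K, ∀ X ∈ L.All K,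
          (cells K (R.u3.C.scale X + Koff) X).Nonempty ∧ TFaceConnected (cells K (R.u3.C.scale X + Koff) X)) ∧
        (∀ K j, Set.InjOn (cells K j) ↑((L.All K).filter fun X => R.u3.C.scale X + Koff = j)) ∧
        (∀ K, ∀ X ∈ L.All K, torusTreeLen (cells K (R.u3.C.scale X + Koff) X) ≤ R.u3.C.d X) ∧
        0 < θ ∧ θ ^ 6 = ((R.ne3.L : ℝ))⁻¹ ∧
        (∀ v ∈ Rd.dom, rd v ∈ R.ne3.dom) ∧
        (∀ k, ∀ v ∈ Rd.dom, Rd.act k v = minAct 4 (sfClass 4 R.ne3.L R.ne3.Nper R.ne3.ε) R.ne3.L R.ne3.Nper k (rd v)) ∧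
        (R.ne3.Nper : ℝ) ^ 4 ≤ Rd.vol ∧
        (∀ s ∈ Window γ, 0 < bsel s ∧ bsel s ≤ γ))
    (htarget : ∀ (F : T4Family) (θ : Stage13HParams F 2) (hP : θ.Provisos₁₃CoPH F 2), ((θ.ZhUnity F 2 ∧ θ.SlotsNondegenerate₁₃ F 2) ∧ ¬ θ.ppSel = ppSelLiveOfRecord F 2 θ.ν θ.τ9 (EOfRecord₁₃ F 2 θ.toStage13Params) (wOfRecord₉ F 2 θ.toStage9Params)) → θ.Admissible F 2 →
        ForSmallCouplings (datumOfRecord₁₃CoPH F 2 θ hP) fun g₀ => ∀ os : List (ULoop F),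
          (RatesHolderAt (datumOfRecord₁₃CoPH F 2 θ hP)
            ⟨ne1OfRecord l₀ Λ F θ hP g₀ os, ne2OfRecord₁₁ (haveI := neZero_blockFactor F; fullGSizedObjects 3 F.hL b aS ν μ α β' c35 p),
              ne3OfRecord₁₁ F { ne3ConstLayerOfRecord₁₁ F 2 (ℓ₃ F) with
                dom := {V | V ∈ ne3DomOfRecord₁₁ F 2 0 0 ∧ V ∈ sfClass 4 F.L (ne3NperOfRecord₁₁ F 0 0) ((ℓ₃ F).ε / B F) 0} },
              u3OfRecord₁₃ θ.toStage13Params (objectsOfRecord₁₃ F 2 θ.toStage13Params (ℓ F θ)) (ksel F θ hP g₀ os)⟩ β ∧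
              ReadOutAt (datumOfRecord₁₃CoPH F 2 θ hP) (u3OfRecord₁₃ θ.toStage13Params (objectsOfRecord₁₃ F 2 θ.toStage13Params (ℓ F θ)) (ksel F θ hP g₀ os)) ∧
              (0 ≤ (u3OfRecord₁₃ θ.toStage13Params (objectsOfRecord₁₃ F 2 θ.toStage13Params (ℓ F θ)) (ksel F θ hP g₀ os)).ρ ∧
                (u3OfRecord₁₃ θ.toStage13Params (objectsOfRecord₁₃ F 2 θ.toStage13Params (ℓ F θ)) (ksel F θ hP g₀ os)).ρ < 1)) →
            ∃ δ : ℕ → ℝ, Target ((F.side : ℝ) ^ 4) 1 δ (fun K => T4GenFunBounds.schemeZ ((datumOfRecord₁₃CoPH F 2 θ hP).scheme g₀) os (K₀ + K))) :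
    SpineGivenEndpointR13SepCoPHV := by
  let lit : (F : T4Family) → (θ : Stage13HParams F 2) → θ.Provisos₁₃CoPH F 2 → (ℕ → ℝ) → List (ULoop F) → Literature.MathematicalPhysics.QuantumFieldTheory.Balaban1983to89.Node00.RateObjects₁₁ 2 :=
    fun F θ _ _ _ =>
      ⟨objectsOfRecord₁₃ F 2 θ.toStage13Params (ℓ F θ),
        fun _ => { ne3ConstLayerOfRecord₁₁ F 2 (ℓ₃ F) with
          dom := {V | V ∈ ne3DomOfRecord₁₁ F 2 0 0 ∧ V ∈ sfClass 4 F.L (ne3NperOfRecord₁₁ F 0 0) ((ℓ₃ F).ε / B F) 0} },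
        fun _ => haveI := neZero_blockFactor F; fullGSizedObjects 3 F.hL b aS ν μ α β' c35 p⟩
  let 𝔯 : YMDAG.UVSplit.RateReading₁₃CoPH 2 := ⟨lit, YMDAG.N14.TopBorn.ne1OfRecord l₀ Λ⟩
  have hpin1 : YMDAG.N14.TopBorn.Ne1PinnedOfRecord 𝔯 := ⟨l₀, Λ, hl₀, hΛ, fun _ _ _ _ _ => rfl⟩
  have hpin2 : ∃ (b aS : ℝ) (ν μ α β' : Fin 4) (c35 p : ℝ), 0 < b ∧ 0 < aS ∧
      ∀ (F : T4Family) (θ : Stage13HParams F 2) (hP : θ.Provisos₁₃CoPH F 2) (g₀ : ℕ → ℝ) (os : List (ULoop F)) (k : ℕ),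
        (𝔯.lit F θ hP g₀ os).ne2 k = haveI := neZero_blockFactor F; fullGSizedObjects 3 F.hL b aS ν μ α β' c35 p :=
    ⟨b, aS, ν, μ, α, β', c35, p, hb, haS, fun _ _ _ _ _ _ => rfl⟩
  have hpinL : Summit.QuantumFields.YangMills.BalabanUVNodes.N16PinnedLayer13CoPH.N16PinnedLoose 𝔯 ℓ₃ B := fun _ _ _ _ _ _ => rfl
  have hpin : ∀ (F : T4Family) (θ : Stage13HParams F 2) (hP : θ.Provisos₁₃CoPH F 2) (g₀ : ℕ → ℝ) (os : List (ULoop F)),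
      (𝔯.lit F θ hP g₀ os).u3 = objectsOfRecord₁₃ F 2 θ.toStage13Params (ℓ F θ) := fun _ _ _ _ _ => rfl
  have hρ : ∀ (F : T4Family) (θ : Stage13HParams F 2), θ.Provisos₁₃CoPH F 2 → (θ.ZhUnity F 2 ∧ θ.SlotsNondegenerate₁₃ F 2) → θ.Admissible F 2 →
      0 ≤ (ℓ F θ).ρ ∧ (ℓ F θ).ρ < 1 := fun F θ hP hG hθ => ⟨(hs F θ hP hG hθ).ρ_nonneg, (hs F θ hP hG hθ).ρ_lt_one⟩
  have hU := fun (F : T4Family) (θ : Stage13HParams F 2) (hP : θ.Provisos₁₃CoPH F 2) (hG : (θ.ZhUnity F 2 ∧ θ.SlotsNondegenerate₁₃ F 2)) (hθ : θ.Admissible F 2) =>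
    u3KernelInputs_of_finiteVolumeLetters F 2 θ.toStage13Params (ℓ F θ) (hs F θ hP hG hθ) (s F θ) (hr F θ hP hG hθ) (hinc F θ hP hG hθ) (hS F θ hP hG hθ)
      (h9 F θ hP hG hθ) (hWall 0 1 F θ hP hG hθ)
  exact fun F θ h v hG hθ _ _ =>
    hybridNE7Under_of_forSmallCouplings_stringwise (Node00.datumOfRecord₁₃SepCoPHV F 2 θ h v)
      (show ForSmallCouplings (Node00.datumOfRecord₁₃SepCoPHV F 2 θ h v) (fun g₀ => StringwiseHybridNE7 ((Node00.datumOfRecord₁₃SepCoPHV F 2 θ h v).scheme g₀)) from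
        bodyBFree₁₃CoPH_of_split (fun F (θ : Stage13HParams F 2) => (θ.ZhUnity F 2 ∧ θ.SlotsNondegenerate₁₃ F 2)) (fun F (θ : Stage13HParams F 2) => θ.ppSel = ppSelLiveOfRecord F 2 θ.ν θ.τ9 (EOfRecord₁₃ F 2 θ.toStage13Params) (wOfRecord₉ F 2 θ.toStage9Params))
          (bodyBFree₁₃CoPH_of_v5pins_bareLedgerReadingV_n16Produced_at_crOfRecord₁₃VAt_cut K₀ jc sh β 𝔯 ℓ s r ℓ₃ g B c'
          (fun F (θ : Stage13HParams F 2) => (θ.ZhUnity F 2 ∧ θ.SlotsNondegenerate₁₃ F 2) ∧ θ.ppSel = ppSelLiveOfRecord F 2 θ.ν θ.τ9 (EOfRecord₁₃ F 2 θ.toStage13Params) (wOfRecord₉ F 2 θ.toStage9Params))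
          ksel hpin1 hpin2 hpinL hpin (fun F hF => h16 F (hF.elim fun θ h => ⟨θ, h.1, h.2.1.1, h.2.2⟩)) (fun F θ hP hRg hθ => hs F θ hP hRg.1 hθ) (fun F θ hP hRg hθ => hκ F θ hP hRg.1 hθ)
          (fun F θ hP hRg hθ => hcr F θ hP hRg.1 hθ) (fun F θ hP hRg hθ => hκ₀ F θ hP hRg.1 hθ) (fun F θ hP hRg hθ => hr F θ hP hRg.1 hθ) (fun F θ hP hRg hθ => hinc F θ hP hRg.1 hθ)
          (fun F θ hP hRg hθ => hS F θ hP hRg.1 hθ) (fun F θ hP hRg hθ => h9 F θ hP hRg.1 hθ) (fun μ ν F θ hP hRg hθ => hWall μ ν F θ hP hRg.1 hθ) hβ23 hβ1 hmatch hend hradii hclass ρ c εTop hloose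
          hρε hεT h8P hU6loc hρb hc (fun F θ hP hRg hθ => hβw F θ hP hRg.1 hθ) (fun _ _ _ hRg _ => ⟨_, hRg.2⟩) hζm h20 h21 hlinkBareV)
          (bodyBFree₁₃CoPH_of_kernels_pin_bFree (crOneTerm₁₃ K₀) 𝔯 ksel (fun {F} (θ : Stage13HParams F 2) => ((θ.ZhUnity F 2 ∧ θ.SlotsNondegenerate₁₃ F 2) ∧ ¬ θ.ppSel = ppSelLiveOfRecord F 2 θ.ν θ.τ9 (EOfRecord₁₃ F 2 θ.toStage13Params) (wOfRecord₉ F 2 θ.toStage9Params))) ℓ β hpin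
            (fun F θ hP hRg hθ => ForSmallCouplings.of_forall fun g₀ os => by
              refine ⟨?_, ?_, ?_⟩
              · exact n14At_rateCarriersOfRecord₁₃CoPH_of_pinned 𝔯 hpin1 F θ hP g₀ os (ksel F θ hP g₀ os)
              · obtain ⟨b, aS, ν, μ, α, β', c35, p, hb, haS, h⟩ := hpin2
                rw [h F θ hP g₀ os]
                exact n15At_fullGSizedObjects_family hb haS ν μ α β' c35 p F
              · show N16HolderAt (rateCarriersOfRecord₁₃CoPH 𝔯 F θ hP g₀ os (ksel F θ hP g₀ os)).ne3 β
                rw [rateCarriers_ne3_of_pinnedLoose hpinL F θ hP g₀ os (ksel F θ hP g₀ os)]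
                exact h16 F ⟨θ, hP, hRg.1, hθ⟩)
            (fun F θ hP hRg hθ => hs F θ hP hRg.1 hθ) (fun F θ hP hRg hθ => hκ F θ hP hRg.1 hθ) (fun F θ hP hRg hθ => hcr F θ hP hRg.1 hθ)
            (fun F θ hP hRg hθ => hρ F θ hP hRg.1 hθ) (h20_shape_crOneTerm₁₃ K₀) (h21_shape_crOneTerm₁₃ K₀)
            (fun F θ hP hRg hθ => (htarget F θ hP hRg hθ).mono fun g₀ hg os hPr =>
              (core_crOneTerm₁₃_iff_target K₀ θ hP g₀ os).2 (hg os hPr))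
            (fun _ θ hP _ _ => ForSmallCouplings.of_forall fun g₀ os => extraction_crOneTerm₁₃ K₀ θ hP g₀ os)
            (fun F θ hP hRg hθ => (hU F θ hP hRg.1 hθ).1) (fun F θ hP hRg hθ => (hU F θ hP hRg.1 hθ).2.1)
            (fun F θ hP hRg hθ => (hU F θ hP hRg.1 hθ).2.2))
          F θ h.toCore hG hθ) _

end Summit.QuantumFields.YangMills.Theorems.BalabanUVNodesN27SpineRecord
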